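import Summits.BirchSwinnertonDyer.BirchSwinnertonDyer.Theorems.EisensteinPrimesResidualIndexHZeroLocal
import Summits.BirchSwinnertonDyer.BirchSwinnertonDyer.Theorems.EisensteinPrimesRamifiedCharNoLocalFixed
import Summits.BirchSwinnertonDyer.BirchSwinnertonDyer.Theorems.EisensteinPrimesCharResidualSelmerKummer
import Summits.BirchSwinnertonDyer.BirchSwinnertonDyer.Theorems.EisensteinPrimesResidualPairStableLine
import Summits.BirchSwinnertonDyer.BirchSwinnertonDyer.Theorems.EisensteinPrimesShapiroBridgeModel
import Summits.BirchSwinnertonDyer.BirchSwinnertonDyer.Theorems.EisensteinPrimesCharLocalInertiaFrobenius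
import Literature.NumberTheory.EllipticCurves.IwasawaTowerTorsionProofs
import HarnessLib

/-!
# Route `EisensteinPrimes`, crux 2 `GoodLatticeBDPValue` (stmt-BirchSwinnertonDyer-19032), line `halves` v20:
# the `H⁰` PACKAGE of `stub_indexInputs` — the thirteen «global H⁰» / «local H⁰ at H ⊓ D_v̄» conjuncts, at the
# stub's exact types, for the residual pair `Φ ↪ (F/𝒪)(θsub)`, `E_K[p]/Φ ↪ (F/𝒪)(θquot)`

Cell `bsd-eis`, width seat `bsd-line-x1-p1-w7` (g0; `--supports -19032`, closes nothing). The mid-level composition of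
the V21 index road (`ResidualIndexAssembly.zpCorank_datumStrictSelmer_add_eq`, LEAD g4, p645893) takes as (H⁰) inputs,
at `N₁ = Φ`, `N₂ = E_K[p]`, `N₃ = E_K[p]/Φ`, `A₁ = (F/𝒪)(θsub)`, `A₂ = E_K[p^∞]`, `A₃ = (F/𝒪)(θquot)`, `H = ker κ`,
`𝔭 = v̄`: the `H`-invariants of each `A_k` are `p`-divisible in themselves; `E_K[p]^H = 0`; `#(E_K[p]/Φ)^H = p^ε`,
`ε = [θquot = 𝟙]`; `Φ^{H ⊓ D_v̄} = 0`; `H ⊓ D_v̄` acts trivially on `E_K[p]/Φ`; `#(E_K[p]/Φ) = p`; `E_K[p^∞]^{H ⊓ D_v̄}`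
finite; the `H ⊓ D_v̄`-invariants of `A₁, A₃` divisible in themselves (KY §1.4, road memo
`Cruxes/GoodLatticeBDPValue/Lines/halves-imprimLambda-index-road.md` step (5)). This file proves all of them on the
binders of crux 2 and bundles them, in the ORDER AND TYPES of the v20 stub `stub_indexInputs` (LEAD g4,
`HOME/line-x1-p1-g4/GoodLatticeBDPValue.v20.lean` l.314–327), for ANY `StableSubgroup` `Φ` of `E_K[p]` with
`#Φ = #(E_K[p]/Φ) = p` and an equivariant embedding `j₃ : E_K[p]/Φ ↪ (F/𝒪)(θquot)` — in particular for the output of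
`ResidualPairStableLine.exists_stableLine_of_isResidualPairOver` (`hZero_package_of_isResidualPairOver`).
* §1 characters: `charModule_subgroup_invariants_divisible` (Teichmüller, `charModule_invariants_divisible`);
  `natCard_quotFixed_eq` — `#(E_K[p]/Φ)^{ker κ} = p^ε` (all of it if `θquot = 𝟙`; else some `g ∈ ker κ` has
  `θquot(g) ≠ 1` by `p`-power descent from `Γ_K`, `exists_mem_inf_kerSubgroup_unitChar_ne_one`, and fixes only `0`).
* §2 the curve: `geomTorsion_eq_zero_of_forall_kerSubgroup_smul_eq` (`E(K_∞)[p] = 0` from `E(K)[p] = 0`,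
  `fixedPoints_kerSubgroup_geomPrimaryTorsion_eq_bot`) and the (vacuous) divisibility of `E(K_∞)[p^∞] = 0`.
* §3 the package `hZero_package` / `hZero_package_of_isResidualPairOver` (13 conjuncts; the local three from
  `…ResidualIndexHZeroLocal`).

HONEST FRAMING: helper theorems only (0 defs, 0 named facts, 0 sorry); no registered stub is closed here (the H⁰
conjuncts are 13 of the 35 of `stub_indexInputs`); no summit statement / BSD / IMC2 / KY Thm. 1.4.1 (iii) is proved;
0 cells move. References: [KellerYin2024] §1.3–§1.4, Lemma 1.2.4; [GreenbergLNM1716] §1 p. 62, §4 p. 109;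
[CastellaGrossiLeeSkinner2022] Lemma 1.2.x («Lemma 13»).
-/

set_option autoImplicit false
-- the route's Theorems namespace repeats the summit name by design (D-0017 nested layout)
set_option linter.dupNamespace false

noncomputable section

open scoped Classical

namespace Summit.BirchSwinnertonDyer.BirchSwinnertonDyer.Theorems.ResidualIndexHZero

open NumberField IsDedekindDomain Field WeierstrassCurve
  Literature.NumberTheory.EllipticCurves Literature.NumberTheory.EllipticCurves.GreenbergSelmer
  Literature.NumberTheory.EllipticCurves.Rank1Residual Literature.NumberTheory.GaloisRepresentations
  Literature.NumberTheory.EllipticCurves.KellerYin2024 Literature.NumberTheory.IwasawaTheory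
  Summit.BirchSwinnertonDyer.Rank1Residual.X2.ResidualDevissageModules
  Summit.BirchSwinnertonDyer.BirchSwinnertonDyer.Theorems.CharResidualSelmerCount
  Summit.BirchSwinnertonDyer.BirchSwinnertonDyer.Theorems.CharResidualSelmerFinite
  Summit.BirchSwinnertonDyer.BirchSwinnertonDyer.Theorems.AnomalousLocalTorsion

/-! ## §1. Characters: invariants divisible; `#(E_K[p]/Φ)^{ker κ} = p^ε` -/

section Character

variable {K : Type} [Field K] [NumberField K] {p : ℕ} [hp : Fact p.Prime]
  (θ : FramedGaloisRep K (padicCoeffIntegers (∅ : Set (PadicAlgCl p))) 1)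

omit [NumberField K] in
/-- **The `G`-invariants of `(F/𝒪)(θ)` are `p`-divisible in themselves, for every subgroup `G ≤ Γ_K`** (`θ` a
Teichmüller lift, `θ^{p−1} = 1`): the `hinv` / `hinvD` hypotheses of the mid-level composition for `A₁, A₃` at
`G = ker κ` and `G = ker κ ⊓ D_v̄`. [cite: KellerYin2024, Lemma 1.2.4 (arXiv:2402.12781v2 TeX L766–772)]
[cite: CastellaGrossiLeeSkinner2022, §1.2 Lemma 1.2.2] -/
theorem charModule_subgroup_invariants_divisible (hθ : ∀ σ : absoluteGaloisGroup K, θ σ ^ (p - 1) = 1)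
    (G : Subgroup (absoluteGaloisGroup K)) :
    ∀ x : charModule (∅ : Set (PadicAlgCl p)) θ, (∀ g : ↥G, g • x = x) →
      ∃ x' : charModule (∅ : Set (PadicAlgCl p)) θ, (∀ g : ↥G, g • x' = x') ∧ p • x' = x :=
  fun x hx ↦ charModule_invariants_divisible θ hθ (G := ↥G) (fun g ↦ (g : absoluteGaloisGroup K))
    (fun _ _ ↦ rfl) x hx

variable (κ : ZpExtension K p) {N : Type} [AddCommGroup N] [DistribMulAction (absoluteGaloisGroup K) N]

/-- **`#N^{ker κ} = p^ε`, `ε = [θ = 𝟙]`**, for a `Γ_K`-module `N` of order `p` embedded equivariantly in `(F/𝒪)(θ)`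
(`θ^{p−1} = 1`; `N = E_K[p]/Φ ≅ 𝔽(𝟙̃)`, `θ = θquot`): if `θ = 𝟙` everything is fixed; otherwise some `g ∈ ker κ` has
`θ(g) ≠ 1` (`p`-power descent from `Γ_K = ⊤`, `exists_mem_inf_kerSubgroup_unitChar_ne_one`) and fixes only `0`
(`eq_zero_of_smul_eq_of_hom`). The `hε` hypothesis of the mid-level composition (V21 step (5): `N_1^G = 𝔽^ε`).
[cite: KellerYin2024, §1.4 (arXiv:2402.12781v2 TeX L1087–1098, L1178–1190)] [cite: GreenbergLNM1716, §4 proof of Prop. 4.8 (p. 109)] -/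
theorem natCard_fixed_kerSubgroup_eq (hθ : ∀ σ : absoluteGaloisGroup K, θ σ ^ (p - 1) = 1) [Finite N]
    (hN : Nat.card N = p) (j : N →+ charModule (∅ : Set (PadicAlgCl p)) θ)
    (hj : ∀ (σ : absoluteGaloisGroup K) (a : N), j (σ • a) = σ • j a) (hinj : Function.Injective j) :
    Nat.card {n : N // ∀ g : ↥κ.kerSubgroup, g • n = n} =
      p ^ (if ∀ σ : absoluteGaloisGroup K, θ σ = 1 then 1 else 0) := by
  by_cases hall : ∀ σ : absoluteGaloisGroup K, θ σ = 1
  · rw [if_pos hall, pow_one]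
    refine (Nat.card_congr (Equiv.subtypeUnivEquiv fun n g ↦ hinj ?_)).trans hN
    change j ((g : absoluteGaloisGroup K) • n) = j n
    rw [hj]
    exact CharLocalInertiaFrobenius.smul_eq_self_of_apply_eq_one θ (hall _) (j n)
  · rw [if_neg hall, pow_zero]
    obtain ⟨σ, hσ⟩ := not_forall.mp hall
    have hσ' : unitChar θ σ ≠ 1 := fun h ↦ hσ ((GreenbergFullAtSelmer.unitChar_eq_one_iff θ σ).mp h)
    have htop : IsClosed ((⊤ : Subgroup (absoluteGaloisGroup K)) : Set (absoluteGaloisGroup K)) := by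
      rw [Subgroup.coe_top]; exact isClosed_univ
    obtain ⟨g, hg, hgne⟩ := exists_mem_inf_kerSubgroup_unitChar_ne_one κ θ hθ ⊤ htop (Subgroup.mem_top σ) hσ'
    have hg' : g ∈ κ.kerSubgroup := (Subgroup.mem_inf.mp hg).2
    haveI : Subsingleton {n : N // ∀ g : ↥κ.kerSubgroup, g • n = n} := ⟨fun a b ↦ Subtype.ext (by
      rw [eq_zero_of_smul_eq_of_hom θ hθ j hj hinj hgne (a.2 ⟨g, hg'⟩),
        eq_zero_of_smul_eq_of_hom θ hθ j hj hinj hgne (b.2 ⟨g, hg'⟩)])⟩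
    haveI : Nonempty {n : N // ∀ g : ↥κ.kerSubgroup, g • n = n} := ⟨⟨0, fun g ↦ smul_zero _⟩⟩
    exact Nat.card_unique

end Character

/-! ## §2. The curve: `E(K_∞)[p] = 0` -/

section Curve

variable {K : Type} [Field K] [NumberField K] {p : ℕ} [hp : Fact p.Prime] (κ : ZpExtension K p)
  (E : WeierstrassCurve K) [E.IsElliptic]

/-- **`E(K_∞)[p^∞] = 0` from `E(K)[p] = 0`**, pointwise (`fixedPoints_kerSubgroup_geomPrimaryTorsion_eq_bot`: pro-`p`
fixed-point principle). [cite: GreenbergLNM1716, §1 p. 62 and §4 p. 109] -/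
theorem geomPrimaryTorsion_eq_zero_of_forall_kerSubgroup_smul_eq
    (htor : ∀ Q : E.toAffine.Point, p • Q = 0 → Q = 0) (x : ↥(E.geomPrimaryTorsion p))
    (hx : ∀ g : ↥κ.kerSubgroup, g • x = x) : x = 0 := by
  have h : x ∈ FixedPoints.addSubgroup ↥κ.kerSubgroup ↥(E.geomPrimaryTorsion p) :=
    (FixedPoints.mem_addSubgroup _ _ _).mpr hx
  rw [E.fixedPoints_kerSubgroup_geomPrimaryTorsion_eq_bot κ htor] at h
  exact (AddSubgroup.mem_bot).mp h

/-- **`E(K_∞)[p] = 0` from `E(K)[p] = 0`**: the `hN₂` hypothesis of the mid-level composition (`N_f^G = 0`, V21 step (5);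
KY L1083 «we could always assume `H⁰(K, ρ̄_f) = 0`», `Γ = Γ_K/ker κ` pro-`p`).
[cite: KellerYin2024, §1.4 (arXiv:2402.12781v2 TeX L1083, L1178–1182)] [cite: GreenbergLNM1716, §4 p. 109] -/
theorem geomTorsion_eq_zero_of_forall_kerSubgroup_smul_eq
    (htor : ∀ Q : E.toAffine.Point, p • Q = 0 → Q = 0) :
    ∀ n : ↥(E.geomTorsion (p : ℤ)), (∀ g : ↥κ.kerSubgroup, g • n = n) → n = 0 := by
  intro n hn
  set x : ↥(E.geomPrimaryTorsion p) := AddSubgroup.inclusion (geomTorsion_le_geomPrimaryTorsion E p) n with hxdef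
  have hx : ∀ g : ↥κ.kerSubgroup, g • x = x := fun g ↦ by
    apply Subtype.ext
    have h := congrArg (fun z : ↥(E.geomTorsion (p : ℤ)) ↦ (z : geomPoints E)) (hn g)
    exact h
  have h0 := geomPrimaryTorsion_eq_zero_of_forall_kerSubgroup_smul_eq κ E htor x hx
  exact AddSubgroup.inclusion_injective _ (by rw [← hxdef, h0, map_zero])

/-- **The `H`-invariants of `E_K[p^∞]` are (vacuously) `p`-divisible in themselves** when `E(K)[p] = 0`: the `hinv₂`
hypothesis of the mid-level composition. [cite: GreenbergLNM1716, §1 p. 62] -/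
theorem geomPrimaryTorsion_kerSubgroup_invariants_divisible
    (htor : ∀ Q : E.toAffine.Point, p • Q = 0 → Q = 0) :
    ∀ x : ↥(E.geomPrimaryTorsion p), (∀ g : ↥κ.kerSubgroup, g • x = x) →
      ∃ x' : ↥(E.geomPrimaryTorsion p), (∀ g : ↥κ.kerSubgroup, g • x' = x') ∧ p • x' = x :=
  fun x hx ↦ ⟨0, fun g ↦ smul_zero _, by
    rw [geomPrimaryTorsion_eq_zero_of_forall_kerSubgroup_smul_eq κ E htor x hx, smul_zero]⟩

end Curve

/-! ## §3. The package: the thirteen `H⁰` conjuncts of `stub_indexInputs`, at the stub's types -/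

section Package

/-- **THE `H⁰` PACKAGE OF `stub_indexInputs` (v20, conjuncts «global H⁰» and «local H⁰ at `H ⊓ D_v̄`», in the stub's
order and types)**, on the binders of crux 2 (`2 < p`, `Anom W p`, no unramified rational `p`-line, `K` imaginary
quadratic, `E(K)[p] = 0`, `v` the place of `ι`, `v̄ ∣ p`, `v̄ ≠ v`, `κ` anticyclotomic, `(θsub, θquot)` the residual
pair), for ANY `Γ_K`-stable line `Φ` of `E_K[p]` in the `StableSubgroup` currency with `#Φ = #(E_K[p]/Φ) = p` and an
equivariant embedding `j₃ : E_K[p]/Φ ↪ (F/𝒪)(θquot)` (e.g. the output of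
`ResidualPairStableLine.exists_stableLine_of_isResidualPairOver`): (1)–(3) the `ker κ`-invariants of `(F/𝒪)(θsub)`,
`E_K[p^∞]`, `(F/𝒪)(θquot)` are `p`-divisible in themselves; (4) `E_K[p]^{ker κ} = 0`; (5)–(6) `(E_K[p]/Φ)^{ker κ}` is
finite of order `p^ε`, `ε = [θquot = 𝟙]`; (7) `Φ^{ker κ ⊓ D_v̄} = 0`; (8) `ker κ ⊓ D_v̄` acts trivially on `E_K[p]/Φ`;
(9)–(10) `E_K[p]/Φ` is finite of order `p`; (11) `E_K[p^∞]^{ker κ ⊓ D_v̄}` is finite; (12)–(13) the `ker κ ⊓ D_v̄`-invariants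
of `(F/𝒪)(θsub)`, `(F/𝒪)(θquot)` are `p`-divisible in themselves. V21 road step (5) («`H⁰` values»).
[cite: KellerYin2024, §1.3 Prop. 1.3.3 (iii), §1.4 Thm. 1.4.1 and Cases I–III (arXiv:2402.12781v2 TeX L948–957, L1066–1098, L1178–1330)]
[cite: GreenbergLNM1716, §1 p. 62, §4 p. 109] -/
theorem hZero_package (W : WeierstrassCurve ℚ) [W.IsElliptic] [W.IsGloballyMinimal] (p : ℕ) [Fact p.Prime]
    (hp : 2 < p) (hanom : Anom W p)
    (hlat : ∀ Φ : AddSubgroup (geomTorsion W (p : ℤ)), IsRationalLine W p Φ → ¬ LineUnramifiedAt W p Φ)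
    (K : Type) [Field K] [NumberField K] (hK : IsImaginaryQuadratic K)
    (htor : ∀ Q : (W.baseChange K).toAffine.Point, p • Q = 0 → Q = 0)
    (ι : K →+* ℚ_[p]) (v vbar : HeightOneSpectrum (𝓞 K))
    (hv : ∀ x : 𝓞 K, x ∈ v.asIdeal ↔ ‖ι (x : K)‖ < 1)
    (hvbar : ((p : ℕ) : 𝓞 K) ∈ vbar.asIdeal) (hne : vbar ≠ v)
    (κ : ZpExtension K p) (hκ : κ.IsAnticyclotomic)
    (θsub θquot : FramedGaloisRep K (padicCoeffIntegers (∅ : Set (PadicAlgCl p))) 1)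
    (hpair : IsResidualPairOver (W.baseChange K) p θsub θquot)
    (Φ : StableSubgroup (absoluteGaloisGroup K) ↥((W.baseChange K).geomTorsion (p : ℤ)))
    (hSub : Nat.card Φ.Sub = p) (hQuot : Nat.card Φ.Quot = p)
    (j₃ : Φ.Quot →+ charModule ∅ θquot)
    (hj₃ : ∀ (g : absoluteGaloisGroup K) (a : Φ.Quot), j₃ (g • a) = g • j₃ a) (hj₃inj : Function.Injective j₃) :
    -- global H⁰
    (∀ x : (charModule ∅ θsub), (∀ g : ↥κ.kerSubgroup, g • x = x) → ∃ x' : (charModule ∅ θsub), (∀ g : ↥κ.kerSubgroup, g • x' = x') ∧ p • x' = x) ∧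
    (∀ x : ↥((W.baseChange K).geomPrimaryTorsion p), (∀ g : ↥κ.kerSubgroup, g • x = x) → ∃ x' : ↥((W.baseChange K).geomPrimaryTorsion p), (∀ g : ↥κ.kerSubgroup, g • x' = x') ∧ p • x' = x) ∧
    (∀ x : (charModule ∅ θquot), (∀ g : ↥κ.kerSubgroup, g • x = x) → ∃ x' : (charModule ∅ θquot), (∀ g : ↥κ.kerSubgroup, g • x' = x') ∧ p • x' = x) ∧
    (∀ n : ↥((W.baseChange K).geomTorsion (p : ℤ)), (∀ g : ↥κ.kerSubgroup, g • n = n) → n = 0) ∧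
    Finite {n : Φ.Quot // ∀ g : ↥κ.kerSubgroup, g • n = n} ∧
    Nat.card {n : Φ.Quot // ∀ g : ↥κ.kerSubgroup, g • n = n} = p ^ (if ∀ σ : absoluteGaloisGroup K, θquot σ = 1 then 1 else 0) ∧
    -- local H⁰ at `H ⊓ D_v̄`
    (∀ n : Φ.Sub, (∀ g : ↥(κ.kerSubgroup ⊓ decomp vbar), g • n = n) → n = 0) ∧
    (∀ (g : ↥(κ.kerSubgroup ⊓ decomp vbar)) (n : Φ.Quot), g • n = n) ∧
    Finite Φ.Quot ∧ Nat.card Φ.Quot = p ∧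
    Finite {x : ↥((W.baseChange K).geomPrimaryTorsion p) // ∀ g : ↥(κ.kerSubgroup ⊓ decomp vbar), g • x = x} ∧
    (∀ x : (charModule ∅ θsub), (∀ g : ↥(κ.kerSubgroup ⊓ decomp vbar), g • x = x) → ∃ x' : (charModule ∅ θsub), (∀ g : ↥(κ.kerSubgroup ⊓ decomp vbar), g • x' = x') ∧ p • x' = x) ∧
    (∀ x : (charModule ∅ θquot), (∀ g : ↥(κ.kerSubgroup ⊓ decomp vbar), g • x = x) → ∃ x' : (charModule ∅ θquot), (∀ g : ↥(κ.kerSubgroup ⊓ decomp vbar), g • x' = x') ∧ p • x' = x) := by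
  have hp2 : p ≠ 2 := by omega
  have hpr : p.Prime := Fact.out
  have hpv : ((p : ℕ) : 𝓞 K) ∈ v.asIdeal := by
    -- `‖ι p‖ = ‖p‖_p < 1` (as in `X11b.natCast_mem_of_forall_mem_iff_norm_lt`)
    refine (hv _).mpr ?_
    rw [show (((p : ℕ) : 𝓞 K) : K) = (p : K) from rfl, map_natCast]
    exact Padic.norm_p_lt_one
  have hθsub : ∀ σ : absoluteGaloisGroup K, θsub σ ^ (p - 1) = 1 := fun σ ↦ (hpair.pow_sub_one σ).1
  have hθquot : ∀ σ : absoluteGaloisGroup K, θquot σ ^ (p - 1) = 1 := fun σ ↦ (hpair.pow_sub_one σ).2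
  haveI : Finite Φ.Quot := Nat.finite_of_card_ne_zero (by rw [hQuot]; exact hpr.ne_zero)
  exact ⟨charModule_subgroup_invariants_divisible θsub hθsub κ.kerSubgroup,
    geomPrimaryTorsion_kerSubgroup_invariants_divisible κ (W.baseChange K) htor,
    charModule_subgroup_invariants_divisible θquot hθquot κ.kerSubgroup,
    geomTorsion_eq_zero_of_forall_kerSubgroup_smul_eq κ (W.baseChange K) htor,
    inferInstance,
    natCard_fixed_kerSubgroup_eq θquot κ hθquot hQuot j₃ hj₃ hj₃inj,
    sub_eq_zero_of_forall_inf_decomp_smul_eq W κ hp2 hanom hlat hK hpv hvbar hne Φ hSub,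
    forall_inf_decomp_smul_quot_eq_self W κ hp2 hanom hlat hK hpv hvbar hne Φ hSub,
    inferInstance, hQuot,
    finite_fixed_geomPrimaryTorsion_inf_decomp W κ hp2 hanom hlat hK hpv hvbar hne hκ,
    charModule_subgroup_invariants_divisible θsub hθsub _,
    charModule_subgroup_invariants_divisible θquot hθquot _⟩

/-- **The package from the residual pair alone**: `IsResidualPairOver` yields the stable line `Φ` with
`#Φ = #(E_K[p]/Φ) = p` and both Kummer embeddings (`ResidualPairStableLine.exists_stableLine_of_isResidualPairOver`), for
which the thirteen `H⁰` conjuncts hold. [cite: KellerYin2024, §1.4 (arXiv:2402.12781v2 TeX L1063–1098)] -/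
theorem exists_stableLine_hZero_package (W : WeierstrassCurve ℚ) [W.IsElliptic] [W.IsGloballyMinimal] (p : ℕ)
    [Fact p.Prime] (hp : 2 < p) (hanom : Anom W p)
    (hlat : ∀ Φ : AddSubgroup (geomTorsion W (p : ℤ)), IsRationalLine W p Φ → ¬ LineUnramifiedAt W p Φ)
    (K : Type) [Field K] [NumberField K] (hK : IsImaginaryQuadratic K)
    (htor : ∀ Q : (W.baseChange K).toAffine.Point, p • Q = 0 → Q = 0)
    (ι : K →+* ℚ_[p]) (v vbar : HeightOneSpectrum (𝓞 K))
    (hv : ∀ x : 𝓞 K, x ∈ v.asIdeal ↔ ‖ι (x : K)‖ < 1)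
    (hvbar : ((p : ℕ) : 𝓞 K) ∈ vbar.asIdeal) (hne : vbar ≠ v)
    (κ : ZpExtension K p) (hκ : κ.IsAnticyclotomic)
    (θsub θquot : FramedGaloisRep K (padicCoeffIntegers (∅ : Set (PadicAlgCl p))) 1)
    (hpair : IsResidualPairOver (W.baseChange K) p θsub θquot) :
    ∃ (Φ : StableSubgroup (absoluteGaloisGroup K) ↥((W.baseChange K).geomTorsion (p : ℤ)))
      (j₁ : Φ.Sub →+ charModule ∅ θsub) (j₃ : Φ.Quot →+ charModule ∅ θquot),
      (∀ (g : absoluteGaloisGroup K) (a : Φ.Sub), j₁ (g • a) = g • j₁ a) ∧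
      (∀ (g : absoluteGaloisGroup K) (a : Φ.Quot), j₃ (g • a) = g • j₃ a) ∧
      Function.Injective j₁ ∧ Function.Injective j₃ ∧
      (∀ x : charModule ∅ θsub, x ∈ j₁.range ↔ p • x = 0) ∧ (∀ x : charModule ∅ θquot, x ∈ j₃.range ↔ p • x = 0) ∧
      Nat.card Φ.Sub = p ∧
      (∀ x : (charModule ∅ θsub), (∀ g : ↥κ.kerSubgroup, g • x = x) → ∃ x' : (charModule ∅ θsub), (∀ g : ↥κ.kerSubgroup, g • x' = x') ∧ p • x' = x) ∧
      (∀ x : ↥((W.baseChange K).geomPrimaryTorsion p), (∀ g : ↥κ.kerSubgroup, g • x = x) → ∃ x' : ↥((W.baseChange K).geomPrimaryTorsion p), (∀ g : ↥κ.kerSubgroup, g • x' = x') ∧ p • x' = x) ∧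
      (∀ x : (charModule ∅ θquot), (∀ g : ↥κ.kerSubgroup, g • x = x) → ∃ x' : (charModule ∅ θquot), (∀ g : ↥κ.kerSubgroup, g • x' = x') ∧ p • x' = x) ∧
      (∀ n : ↥((W.baseChange K).geomTorsion (p : ℤ)), (∀ g : ↥κ.kerSubgroup, g • n = n) → n = 0) ∧
      Finite {n : Φ.Quot // ∀ g : ↥κ.kerSubgroup, g • n = n} ∧
      Nat.card {n : Φ.Quot // ∀ g : ↥κ.kerSubgroup, g • n = n} = p ^ (if ∀ σ : absoluteGaloisGroup K, θquot σ = 1 then 1 else 0) ∧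
      (∀ n : Φ.Sub, (∀ g : ↥(κ.kerSubgroup ⊓ decomp vbar), g • n = n) → n = 0) ∧
      (∀ (g : ↥(κ.kerSubgroup ⊓ decomp vbar)) (n : Φ.Quot), g • n = n) ∧
      Finite Φ.Quot ∧ Nat.card Φ.Quot = p ∧
      Finite {x : ↥((W.baseChange K).geomPrimaryTorsion p) // ∀ g : ↥(κ.kerSubgroup ⊓ decomp vbar), g • x = x} ∧
      (∀ x : (charModule ∅ θsub), (∀ g : ↥(κ.kerSubgroup ⊓ decomp vbar), g • x = x) → ∃ x' : (charModule ∅ θsub), (∀ g : ↥(κ.kerSubgroup ⊓ decomp vbar), g • x' = x') ∧ p • x' = x) ∧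
      (∀ x : (charModule ∅ θquot), (∀ g : ↥(κ.kerSubgroup ⊓ decomp vbar), g • x = x) → ∃ x' : (charModule ∅ θquot), (∀ g : ↥(κ.kerSubgroup ⊓ decomp vbar), g • x' = x') ∧ p • x' = x) := by
  obtain ⟨Φ, hSub, hQuot, ⟨j₁, hj₁, hj₁inj, hr₁⟩, ⟨j₃, hj₃, hj₃inj, hr₃⟩⟩ :=
    ResidualPairStableLine.exists_stableLine_of_isResidualPairOver (W.baseChange K) hpair
  exact ⟨Φ, j₁, j₃, hj₁, hj₃, hj₁inj, hj₃inj, hr₁, hr₃, hSub, hZero_package W p hp hanom hlat K hK htor ι v vbar hv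
    hvbar hne κ hκ θsub θquot hpair Φ hSub hQuot j₃ hj₃ hj₃inj⟩

end Package

end Summit.BirchSwinnertonDyer.BirchSwinnertonDyer.Theorems.ResidualIndexHZero

end
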